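import Summits.CriticalPhenomena.PercolationContinuityZ3.Theorems.PercNearOneGluingNoHeavyLowerTailSahiAbsorbedComparable

/-!
# The value-level C-slot SIGN law for EVERY weight: `sign E_{n+2}(1_{{x}}, 1_{U_0}, …, 1_{U_n}) = [x ∈ ∩_j U_j]`

Support file (lane `prim-masterthm-p3`, generation 18; `--supports stmt-CriticalPhenomena-4575`).  Pure proofs, no definitions,
no `sorry`, standard axioms.

For a nonnegative weight of mass one on a finite preorder and up-sets `U_0, …, U_n`, the VALUE-LEVEL PROFILE
`x ↦ E_{n+2}(1_{{x}}, 1_{U_0}, …, 1_{U_n})` (so that `E_{n+2}(1_W, 1_U) = Σ_{x∈W} profile(x)`, `sahiE_cons_setInd_eq_sum_single`) satisfies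
* `sahiE_cons_single_nonneg_of_mem`: `x ∈ ∩_j U_j ⟹ profile(x) ≥ 0` (the absorbed-member theorem; unconditional, the `U_j` may be arbitrary finsets);
* `sahiE_cons_single_nonpos` (`…SahiAbsorbedComparable`): `x ∉ U_{j₀}` ⟹ `profile(x) ≤ 0`, given Sahi positivity at the orders `≤ n+1`;
hence the head-monotonicity laws `sahiE_cons_le_insert_of_mem` (adding a meet point to the head event does not decrease `E_{n+2}`) and
`sahiE_cons_insert_le_of_not_mem` (adding a point outside some `U_j` does not increase it), and at ORDER 3 under every FKG weight the
unconditional sign law `sahiE_three_single_sign` — the value shadow, for general lattices and weights, of cell `prim-sahi`'s grid-level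
C-slot sign structure and of this lane's pattern-level SIGN law. [this work]
-/

namespace Summit.CriticalPhenomena.PercolationContinuityZ3.Theorems

open Finset Function
open Literature.Combinatorics.Sahi2008

namespace SahiAbsorbed

section Profile

variable {α : Type*} [Fintype α] [Preorder α] [DecidableEq α] {μ : α → ℝ} {n : ℕ}

omit [Preorder α] in
/-- **SIGN⁺ at the value level** (every probability weight, arbitrary finsets): `x ∈ ∩_j U_j ⟹ E_{n+2}(1_{{x}}, 1_U) ≥ 0`. [this work] -/
theorem sahiE_cons_single_nonneg_of_mem (hμ0 : ∀ y, 0 ≤ μ y) (hμ1 : ∑ y, μ y = 1) (U : Fin (n + 1) → Finset α) {x : α}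
    (hx : ∀ j, x ∈ U j) : 0 ≤ sahiE μ (n + 2) (Fin.cons (setInd {x}) (fun j => setInd (U j))) :=
  sahiE_setInd_cons_nonneg_of_subset hμ0 hμ1 {x} U fun j => singleton_subset_iff.2 (hx j)

omit [Preorder α] in
/-- **Monotone on the meet** (every probability weight): adding to the head event a point of `∩_j U_j` does not decrease `E_{n+2}`. [this work] -/
theorem sahiE_cons_le_insert_of_mem (hμ0 : ∀ y, 0 ≤ μ y) (hμ1 : ∑ y, μ y = 1) (W : Finset α) (U : Fin (n + 1) → Finset α)
    {x : α} (hxW : x ∉ W) (hx : ∀ j, x ∈ U j) :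
    sahiE μ (n + 2) (Fin.cons (setInd W) (fun j => setInd (U j))) ≤
      sahiE μ (n + 2) (Fin.cons (setInd (insert x W)) (fun j => setInd (U j))) := by
  rw [sahiE_cons_setInd_eq_sum_single μ (insert x W), sahiE_cons_setInd_eq_sum_single μ W, sum_insert hxW]
  have := sahiE_cons_single_nonneg_of_mem hμ0 hμ1 U hx
  linarith

/-- **Antitone off the meet** (given the lower orders): adding to the head event a point outside some `U_{j₀}` does not increase
`E_{n+2}`. [this work] -/
theorem sahiE_cons_insert_le_of_not_mem (hμ0 : ∀ y, 0 ≤ μ y) (hpos : ∀ k, 1 ≤ k → k ≤ n + 1 → SahiPositive μ k)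
    (W : Finset α) (U : Fin (n + 1) → Finset α) (hU : ∀ j, IsUpperSet (U j : Set α)) {x : α} (hxW : x ∉ W)
    {j₀ : Fin (n + 1)} (hx : x ∉ U j₀) :
    sahiE μ (n + 2) (Fin.cons (setInd (insert x W)) (fun j => setInd (U j))) ≤
      sahiE μ (n + 2) (Fin.cons (setInd W) (fun j => setInd (U j))) := by
  rw [sahiE_cons_setInd_eq_sum_single μ (insert x W), sahiE_cons_setInd_eq_sum_single μ W, sum_insert hxW]
  have := sahiE_cons_single_nonpos hμ0 hpos U hU hx
  linarith

end Profile

section OrderThree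

variable {α : Type*} [Fintype α] [DistribLattice α] [DecidableEq α] {μ : α → ℝ}

/-- **The value-level C-slot sign law at order 3, every FKG weight, unconditional**: for up-sets `A, B` and a point `x`,
`E_3(1_{{x}}, 1_A, 1_B) ≥ 0` if `x ∈ A ∩ B` and `≤ 0` otherwise. [this work] -/
theorem sahiE_three_single_sign (hμ : IsFKGMeasure μ) (A B : Finset α) (hA : IsUpperSet (A : Set α)) (hB : IsUpperSet (B : Set α)) (x : α) :
    (x ∈ A ∩ B → 0 ≤ sahiE μ 3 (Fin.cons (setInd {x}) (fun j => setInd ((![A, B] : Fin 2 → Finset α) j)))) ∧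
    (x ∉ A ∩ B → sahiE μ 3 (Fin.cons (setInd {x}) (fun j => setInd ((![A, B] : Fin 2 → Finset α) j))) ≤ 0) := by
  have hpos : ∀ k, 1 ≤ k → k ≤ 2 → SahiPositive μ k := by
    intro k hk1 hk2
    interval_cases k
    · exact sahiPositive_one hμ.nonneg
    · exact sahiPositive_two hμ
  have hU : ∀ j : Fin 2, IsUpperSet (((![A, B] : Fin 2 → Finset α) j : Finset α) : Set α) := by
    intro j; fin_cases j
    · exact hA
    · exact hB
  refine ⟨fun hx => ?_, fun hx => ?_⟩
  · rw [mem_inter] at hx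
    exact sahiE_cons_single_nonneg_of_mem (n := 1) hμ.nonneg hμ.sum_eq_one _ fun j => by
      fin_cases j
      · exact hx.1
      · exact hx.2
  · rw [mem_inter, not_and_or] at hx
    rcases hx with h | h
    · exact sahiE_cons_single_nonpos (n := 1) (j₀ := 0) hμ.nonneg hpos _ hU h
    · exact sahiE_cons_single_nonpos (n := 1) (j₀ := 1) hμ.nonneg hpos _ hU h

end OrderThree

end SahiAbsorbed

end Summit.CriticalPhenomena.PercolationContinuityZ3.Theorems
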